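import Summits.QuantumFields.YangMills.Theorems.FluctuationComparisonRegPrIntLS2BetaResidualGauge
import HarnessLib

/-!
# GAP♯∘'s KINEMATIC LETTER — THE INDUCTION DOOR: CLOSE-PAIR∘ ⟸ {ONE-STEP∘, SUM∘}
# ([Balaban1985RegularSpaces] Lemma 1 on ONE averaging step, iterated down the `(K−J)`-fold history along the decreasing thresholds `θBal(K−i)`)
# (crux `FluctuationComparisonRegPrIntL`, stmt-QuantumFields-20520; registry v11.4 `Cruxes/FluctuationComparisonRegPrIntL/Lines/semiclassical_s2beta.lean` 3732b7df FROZEN, untouched)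

Cell `ym3-torus` (YM ladder rung R3 = continuum `SU(2)` Yang–Mills on the three-torus — a RUNG: NOT d = 4, NOT infinite volume, NOT a mass gap, NOT Clay).
Seat `ymfull-r3-prover-3` (gen 0; R590-ym (a) item (3) GAP♯∘ `stub_uniformFibreGapOrbit`; LEAD w3 g23 №3 (4) DIVISION: this seat = the quantitative side + the
kinematic closeness CLOSE∘∕CLOSE-PAIR∘); `--kind proof --supports stmt-QuantumFields-20520 --as helper`, count-neutral, DEFINITION-FREE (0 `def`, 0 `instance`,
0 `notation`, 0 `sorry`, default heartbeats).  Third file of the seat, after ✓p784151 `…S2BetaGapOrbitOfTubeClose` (GAP♯∘ ⟸ {TUBE∘, CLOSE∘}) and ✓p784179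
`…S2BetaGapOrbitOfTubeReg` (GAP♯∘ ⟸ {TUBE-REG∘, CLOSE-PAIR∘, Thm-1 letter}).

WHAT CLOSE-PAIR∘ SAYS (the hypothesis `hP` of ✓`uniformFibreGapOrbit_of_tubeReg_of_closePair`, VERBATIM below as the conclusion of §3): below a coupling threshold
`γ₁(L, b₀, p₀, δ)`, ANY two good histories `U′, U` over one datum (`U′, U ∈ fibre F ℰp J K hJK V`, both in `histGood(θBal b₀) K J`) are `δ`-close in sup modulo a RESIDUAL
fine gauge transformation: `∃ w residual, ∀ ℓ, dist1(U ℓ·((w•U′) ℓ)⁻¹) ≤ δ` — uniformly in the depth `K − J`.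

WHY IT HOLDS IN PRINT (and why the constant is depth-free).  [Balaban1985UV3] p.259 (after (12)) applies [Balaban1985RegularSpaces] Lemma 1 (1.24)–(1.26) to ONE
averaging step: two configurations with plaquette variables `< α₀` whose block averages agree up to `α₁` (modulo a coarse transformation) are `(α₁ + C_L·α₀)`-close
in the block-axial gauge modulo a fine transformation restricting to the coarse one — with coefficient ONE on `α₁` (intra-block bonds: comb-fan Stokes, `C_L·α₀`,
the tree's ✓`Prop7AxialGaugeBlock.dist1_mul_inv_le_interior`; inter-block bonds: the averaging constraint, each crossing bond within `C_L·α₀` of its block average —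
that file's recorded TODO «(1.25) on the bonds joining two blocks»).  Iterating DOWN the history from the datum (height `K − J`, where the two averaged fields are
EQUAL) to the finest lattice accumulates `δ ≤ C_L·Σ_{i<K−J} θBal(K−i) = C_L·Σ_{i′=J+1}^{K} θBal(i′)`, a geometric series (`θBal(i′) ≤ C₀·γ^{1∕4}·L^{−i′∕4}`,
✓`T3Thresholds.θBal_le_const_mul_sqrt_coupling`) — so `δ → 0` as `γ → 0` UNIFORMLY in `J ≤ K`, and the composite fine transformation restricts to `1` on the
comparison lattice, hence is residual (✓`residual_of_descTransf_eq_one`).  This is the «multi-step closeness implicit in the induction, never a statement» of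
px17 g14's LOCATE-ORB §2, made a statement.

DISPLAYED LETTERS (binder-free; the analytic one-step content and the threshold arithmetic are NOT proved here):
* **ONE-STEP∘** — `∀ L, ∃ C ≥ 0, ∃ a₀ > 0, ∀ F (F.L = L) K i (i < K) (X X′ : height-i fields of run K) (w̄ : height-(i+1) transformation) α₀ ∈ [0, a₀] α₁ ≥ 0`,
  `PlaqSmall α₀ X → PlaqSmall α₀ X′ → (∀ b, dist1((avg X′) b·((w̄ • avg X) b)⁻¹) ≤ α₁) → ∃ w, (w ∘ emb = w̄) ∧ ∀ ℓ, dist1(X′ ℓ·((w • X) ℓ)⁻¹) ≤ α₁ + C·α₀`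
  (`avg` = the (0.4) averaging of record `BlockAveraging.blockAvg ℰp` at height `i` of the tower `F.P K`).  Print: [Balaban1985RegularSpaces] Lemma 1 (1.24)–(1.26)
  pp.79–80; [Balaban1985UV3] p.259.  Size M (one block-axial gauge + comb-fan Stokes + the mean-of-near-identical property of `ℰp`).
* **SUM∘** — `∀ L > 1, ∀ b₀ p₀ > 0, ∀ C ≥ 0, a₀ > 0, δ > 0, ∃ γ₁ > 0, ∀ γ ∈ (0, γ₁]`: `0 ≤ θBal L γ b₀ p₀ i ≤ a₀` for all `i` and
  `C·Σ_{i<K−J} θBal L γ b₀ p₀ (K−i) ≤ δ` for all `J ≤ K` (elementary: the geometric bound above; displayed, not proved here).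

WHAT IS PROVED (sorry-free bookkeeping + one genuine induction).
* §1 tower bookkeeping: `iter_eq_of_mem_fibre` (two fields of one fibre have EQUAL `(K−J)`-fold averages — `fieldShift` is injective), `transfUp_eq_of_chain` (a level-wise
  chain `ws i ∘ emb = ws (i+1)` is the restriction up the centres of its bottom: `transfUp (ws 0) i = ws i`), `residual_of_transfUp_eq_one`.
* §2 ★★ `chain_of_oneStep` — THE DESCENDING INDUCTION on one tower: from the one-step letter (at a constant `C`, guard `a₀`), thresholds `θ ≤ a₀`, small plaquettes of all
  averages of `U, U′` up to height `k ≤ K` and EQUAL `k`-fold averages, a fine `w` with `transfUp w k ≡ 1` and `dist1(U′ ℓ·((w•U) ℓ)⁻¹) ≤ C·Σ_{i<k} θ(K−i)` on every fine bond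
  (dependent `Function.update` of the chain of transformations, `Finset.sum_eq_sum_Ico_succ_bot`).
* §3 ★★★ `closePair_of_oneStep_of_sum (h1 : ⟨ONE-STEP∘⟩) (hS : ⟨SUM∘⟩) : ⟨CLOSE-PAIR∘ VERBATIM⟩` (= ✓p784179's `hP` ∕ ✓p784151's `close_of_closePair` input, token for token).

NET (CREDIT NOTHING): «CLOSE-PAIR∘ modulo letters {ONE-STEP∘, SUM∘}»; with ✓p784179: «GAP♯∘ modulo {TUBE-REG∘, ONE-STEP∘, SUM∘, Thm-1 letter}».  HONEST: a door + an induction;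
ONE-STEP∘ (Lemma 1 of [Balaban1985RegularSpaces] on the T³ tower), SUM∘, TUBE-REG∘, GAP♯∘, EXW∘, S2β, crux 20520 are NOT proved here; no summit statement is proved by a helper;
finite-volume ∕ conditional; rung R3 = SU(2) YM₃ on T³ — NOT d = 4, NOT infinite volume, NOT a mass gap, NOT Clay; the Yang–Mills mass gap is NOT proved.  Sorry-free, axioms standard.

References: T. Bałaban, CMP **99** (1985) 75–102 [Balaban1985RegularSpaces] (Lemma 1 (1.24)–(1.26) pp.79–80); CMP **102** (1985) 255–275 [Balaban1985UV3] ((7) p.257, (12)–(13)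
pp.258–259); CMP **98** (1985) 17–51 [Balaban1985Averaging] ((11)–(13) p.19).
-/

set_option autoImplicit false

noncomputable section

open MeasureTheory Filter Topology Set
open scoped Matrix.Norms.L2Operator
open Literature.MathematicalPhysics.QuantumFieldTheory.Balaban1983to89
open Literature.MathematicalPhysics.QuantumFieldTheory.Balaban1983to89.T3ContinuumYM3Torus
open Literature.MathematicalPhysics.QuantumFieldTheory.Balaban1983to89.T3UnitLawDensityEML
open Literature.MathematicalPhysics.QuantumFieldTheory.Balaban1983to89.T3UnitScaleTilt
open Literature.MathematicalPhysics.QuantumFieldTheory.Balaban1983to89.T3TiltDescent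
open Literature.MathematicalPhysics.QuantumFieldTheory.Balaban1983to89.T3LevelShift
open Literature.MathematicalPhysics.QuantumFieldTheory.Balaban1983to89.T3PrintedRegularMinimiser
open Literature.MathematicalPhysics.QuantumFieldTheory.Balaban1983to89.T3PrintedRegularOrbits
open Literature.MathematicalPhysics.QuantumFieldTheory.Balaban1983to89.T3ConstrainedMinimiser (fibre)
open Literature.MathematicalPhysics.QuantumFieldTheory.Balaban1983to89.Missing
open Literature.MathematicalPhysics.QuantumFieldTheory.Balaban1983to89.T4Continuum
open Summit.QuantumFields.YangMills.Theorems.FluctuationComparisonRegPrIntLS2BetaResidualGauge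

namespace Summit.QuantumFields.YangMills.Theorems.FluctuationComparisonRegPrIntLS2BetaClosePairOfOneStep

/-! ## §1 Tower bookkeeping -/

section Tower

variable (F : T3Family) {J K : ℕ} (hJK : J ≤ K)

/-- Two fields of one fibre have EQUAL `(K−J)`-fold averages (the descent is the average read through the injective `fieldShift`).
[cite: Balaban1987RG1, (0.11) p.253] -/
theorem iter_eq_of_mem_fibre {V : GaugeField (F.P J) 0 (Matrix.specialUnitaryGroup (Fin 2) ℂ)}
    {U U' : GaugeField (F.P K) 0 (Matrix.specialUnitaryGroup (Fin 2) ℂ)}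
    (hU : U ∈ fibre F ℰp J K hJK V) (hU' : U' ∈ fibre F ℰp J K hJK V) :
    Averaging.iter (fun i => BlockAveraging.blockAvg (P := F.P K) (j := i) ℰp) (K - J) U =
      Averaging.iter (fun i => BlockAveraging.blockAvg (P := F.P K) (j := i) ℰp) (K - J) U' := by
  have h1 : descendTo F ℰp J K hJK U = descendTo F ℰp J K hJK U' := hU.trans hU'.symm
  unfold descendTo at h1
  have h2 := congrArg (fieldShift (F.sitesPerDir_eq (m := F.m) (K := J) (j := 0) (m' := F.m) (K' := K) (j' := K - J) (by omega)).symm) h1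
  rwa [fieldShift_fieldShift_symm, fieldShift_fieldShift_symm] at h2

/-- A LEVEL-WISE CHAIN `ws i ∘ emb = ws (i+1)` (`i < k`) is the restriction up the block centres of its bottom: `transfUp (ws 0) i = ws i` for `i ≤ k`.
[cite: Balaban1985Averaging, (12)-(13) p.19] -/
theorem transfUp_eq_of_chain {P : Params} {G : Type*} (ws : (i : ℕ) → GaugeTransf P i G) (k : ℕ)
    (hchain : ∀ i, i < k → (fun y => ws i (emb y)) = ws (i + 1)) : ∀ i, i ≤ k → transfUp (ws 0) i = ws i
  | 0, _ => rfl
  | i + 1, hi => by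
    funext y
    show transfUp (ws 0) i (emb y) = ws (i + 1) y
    rw [transfUp_eq_of_chain ws k hchain i (Nat.le_of_succ_le hi)]
    exact congrFun (hchain i (Nat.lt_of_succ_le hi)) y

/-- A fine transformation whose restriction up `K − J` levels is `≡ 1` descends to `1` on the comparison lattice, hence is RESIDUAL.
[cite: Balaban1985Variational, (4) p.278] -/
theorem residual_of_transfUp_eq_one {w : Site (F.P K) 0 → Matrix.specialUnitaryGroup (Fin 2) ℂ}
    (hw : transfUp w (K - J) = fun _ => 1) :
    ∀ U : GaugeField (F.P K) 0 (Matrix.specialUnitaryGroup (Fin 2) ℂ),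
      descendTo F ℰp J K hJK (GaugeField.gaugeAct w U) = descendTo F ℰp J K hJK U := by
  refine residual_of_descTransf_eq_one F hJK ?_
  funext x
  show transfUp w (K - J) (siteShift (sites_eq F J K hJK) x) = 1
  rw [hw]

end Tower

/-! ## §2 The descending induction on one tower -/

section Induction

variable (F : T3Family)

/-- ★★ **THE CHAIN OF ONE-STEP CLOSENESSES, DOWN THE HISTORY.**  On the tower of run `K`, given the one-step letter at a constant `C ≥ 0` with guard `a₀` (two height-`i`
fields with plaquettes `< α₀ ≤ a₀` whose averages are `α₁`-close modulo `w̄` are `(α₁ + C·α₀)`-close modulo a fine `w` with `w ∘ emb = w̄`), thresholds `0 ≤ θ ≤ a₀`, two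
finest fields `U, U′` all of whose averages up to height `k ≤ K` have plaquettes `< θ(K − i)` and whose `k`-fold averages are EQUAL: a fine `w` with `transfUp w k ≡ 1`
and `dist1(U′ ℓ·((w•U) ℓ)⁻¹) ≤ C·Σ_{i<k} θ(K−i)` on every fine bond. [cite: Balaban1985UV3, (12)-(13) p.259; Balaban1985RegularSpaces, Lemma 1 (1.24)-(1.26) pp.79-80] -/
theorem chain_of_oneStep (K k : ℕ) (hk : k ≤ K) {C a₀ : ℝ} (hC : 0 ≤ C)
    (h1 : ∀ i : ℕ, i < K → ∀ (X X' : GaugeField (F.P K) i (Matrix.specialUnitaryGroup (Fin 2) ℂ))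
      (wbar : Site (F.P K) (i + 1) → Matrix.specialUnitaryGroup (Fin 2) ℂ) (α₀ α₁ : ℝ), 0 ≤ α₀ → α₀ ≤ a₀ → 0 ≤ α₁ →
      PlaqSmall α₀ X → PlaqSmall α₀ X' →
      (∀ b : PBond (F.P K) (i + 1),
        dist1 (((BlockAveraging.blockAvg (P := F.P K) (j := i) ℰp).avg X') b *
          ((GaugeField.gaugeAct wbar ((BlockAveraging.blockAvg (P := F.P K) (j := i) ℰp).avg X)) b)⁻¹) ≤ α₁) →
      ∃ w : Site (F.P K) i → Matrix.specialUnitaryGroup (Fin 2) ℂ,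
        (fun y => w (emb y)) = wbar ∧ ∀ ℓ : PBond (F.P K) i, dist1 (X' ℓ * ((GaugeField.gaugeAct w X) ℓ)⁻¹) ≤ α₁ + C * α₀)
    (θ : ℕ → ℝ) (hθ0 : ∀ i, 0 ≤ θ i) (hθa : ∀ i, θ i ≤ a₀)
    (U U' : GaugeField (F.P K) 0 (Matrix.specialUnitaryGroup (Fin 2) ℂ))
    (hU : ∀ i, i ≤ k → PlaqSmall (θ (K - i)) (Averaging.iter (fun i => BlockAveraging.blockAvg (P := F.P K) (j := i) ℰp) i U))
    (hU' : ∀ i, i ≤ k → PlaqSmall (θ (K - i)) (Averaging.iter (fun i => BlockAveraging.blockAvg (P := F.P K) (j := i) ℰp) i U'))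
    (htop : Averaging.iter (fun i => BlockAveraging.blockAvg (P := F.P K) (j := i) ℰp) k U =
      Averaging.iter (fun i => BlockAveraging.blockAvg (P := F.P K) (j := i) ℰp) k U') :
    ∃ w : Site (F.P K) 0 → Matrix.specialUnitaryGroup (Fin 2) ℂ,
      transfUp w k = (fun _ => 1) ∧
        ∀ ℓ : PBond (F.P K) 0, dist1 (U' ℓ * ((GaugeField.gaugeAct w U) ℓ)⁻¹) ≤ C * ∑ i ∈ Finset.range k, θ (K - i) := by
  set av : ∀ i, Averaging (F.P K) i (Matrix.specialUnitaryGroup (Fin 2) ℂ) :=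
    fun i => BlockAveraging.blockAvg (P := F.P K) (j := i) ℰp with hav
  -- T(n): a chain of transformations from height `k − n` up to `k`
  have key : ∀ n : ℕ, n ≤ k → ∃ ws : (i : ℕ) → (Site (F.P K) i → Matrix.specialUnitaryGroup (Fin 2) ℂ),
      ws k = (fun _ => 1) ∧
      (∀ i, k - n ≤ i → i < k → (fun y => ws i (emb y)) = ws (i + 1)) ∧
      (∀ i, k - n ≤ i → i ≤ k → ∀ ℓ : PBond (F.P K) i,
        dist1 ((Averaging.iter av i U') ℓ * ((GaugeField.gaugeAct (ws i) (Averaging.iter av i U)) ℓ)⁻¹) ≤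
          C * ∑ i' ∈ Finset.Ico i k, θ (K - i')) := by
    intro n
    induction n with
    | zero =>
      intro _
      refine ⟨fun _ => fun _ => 1, rfl, fun i hi hik => absurd hik (not_lt.mpr (by omega)), fun i hi hik ℓ => ?_⟩
      have hieq : i = k := by omega
      subst hieq
      rw [B12RTGaugeInvariance254.gaugeAct_one', htop, mul_inv_cancel, GaugeGroup.dist1_one, Finset.Ico_self, Finset.sum_empty, mul_zero]
    | succ n ih =>
      intro hn
      obtain ⟨ws, hwsk, hchain, hdist⟩ := ih (Nat.le_of_succ_le hn)
      -- the new level `m := k − (n+1)`, with `m + 1 = k − n`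
      set m := k - (n + 1) with hm
      have hm1 : m + 1 = k - n := by omega
      have hmK : m < K := by omega
      have hmk : m < k := by omega
      -- one step at height `m`
      have hα₁ : 0 ≤ C * ∑ i' ∈ Finset.Ico (m + 1) k, θ (K - i') := mul_nonneg hC (Finset.sum_nonneg fun i _ => hθ0 _)
      have havg : ∀ b : PBond (F.P K) (m + 1),
          dist1 (((av m).avg (Averaging.iter av m U')) b *
            ((GaugeField.gaugeAct (ws (m + 1)) ((av m).avg (Averaging.iter av m U))) b)⁻¹) ≤
            C * ∑ i' ∈ Finset.Ico (m + 1) k, θ (K - i') := by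
        intro b
        have h := hdist (m + 1) (by omega) (by omega) b
        exact h
      obtain ⟨w, hwemb, hwdist⟩ := h1 m hmK (Averaging.iter av m U) (Averaging.iter av m U') (ws (m + 1)) (θ (K - m))
        (C * ∑ i' ∈ Finset.Ico (m + 1) k, θ (K - i')) (hθ0 _) (hθa _) hα₁ (hU m hmk.le) (hU' m hmk.le) havg
      refine ⟨Function.update ws m w, ?_, ?_, ?_⟩
      · rw [Function.update_of_ne (by omega : k ≠ m)]; exact hwsk
      · intro i hi hik
        by_cases him : i = m
        · subst him
          rw [Function.update_self, Function.update_of_ne (by omega : m + 1 ≠ m)]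
          exact hwemb
        · rw [Function.update_of_ne him, Function.update_of_ne (by omega : i + 1 ≠ m)]
          exact hchain i (by omega) hik
      · intro i hi hik ℓ
        by_cases him : i = m
        · subst him
          rw [Function.update_self]
          refine (hwdist ℓ).trans (le_of_eq ?_)
          rw [Finset.sum_eq_sum_Ico_succ_bot hmk, mul_add, add_comm]
        · rw [Function.update_of_ne him]
          exact hdist i (by omega) hik ℓ
  obtain ⟨ws, hwsk, hchain, hdist⟩ := key k le_rfl
  refine ⟨ws 0, ?_, fun ℓ => ?_⟩
  · rw [transfUp_eq_of_chain ws k (fun i hi => hchain i (by omega) hi) k le_rfl]; exact hwsk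
  · have h := hdist 0 (by omega) (Nat.zero_le _) ℓ
    rw [Finset.range_eq_Ico]
    exact h

end Induction

/-! ## §3 The door: ONE-STEP∘ ∧ SUM∘ → CLOSE-PAIR∘ -/

section Door

/-- ★★★ **ONE-STEP∘ ∧ SUM∘ ⟹ CLOSE-PAIR∘** (conclusion = the pair-closeness letter of ✓p784151 ∕ ✓p784179 VERBATIM).  At a datum: the two good histories have equal
`(K−J)`-fold averages (§1) and small plaquettes at every height (`histGood`); SUM∘ supplies the guard `θBal ≤ a₀` and `C·Σ_{i<K−J} θBal(K−i) ≤ δ`; §2 chains ONE-STEP∘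
down the history; the resulting fine `w` has `transfUp w (K−J) ≡ 1`, hence is residual (§1).
[cite: Balaban1985RegularSpaces, Lemma 1 (1.24)-(1.26) pp.79-80; Balaban1985UV3, (12)-(13) p.259 and (7) p.257] -/
theorem closePair_of_oneStep_of_sum
    (h1 : ∀ (L : ℕ), ∃ C : ℝ, 0 ≤ C ∧ ∃ a₀ : ℝ, 0 < a₀ ∧ ∀ (F : T3Family), F.L = L → ∀ (K i : ℕ), i < K →
      ∀ (X X' : GaugeField (F.P K) i (Matrix.specialUnitaryGroup (Fin 2) ℂ))
        (wbar : Site (F.P K) (i + 1) → Matrix.specialUnitaryGroup (Fin 2) ℂ) (α₀ α₁ : ℝ), 0 ≤ α₀ → α₀ ≤ a₀ → 0 ≤ α₁ →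
        PlaqSmall α₀ X → PlaqSmall α₀ X' →
        (∀ b : PBond (F.P K) (i + 1),
          dist1 (((BlockAveraging.blockAvg (P := F.P K) (j := i) ℰp).avg X') b *
            ((GaugeField.gaugeAct wbar ((BlockAveraging.blockAvg (P := F.P K) (j := i) ℰp).avg X)) b)⁻¹) ≤ α₁) →
        ∃ w : Site (F.P K) i → Matrix.specialUnitaryGroup (Fin 2) ℂ,
          (fun y => w (emb y)) = wbar ∧ ∀ ℓ : PBond (F.P K) i, dist1 (X' ℓ * ((GaugeField.gaugeAct w X) ℓ)⁻¹) ≤ α₁ + C * α₀)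
    (hS : ∀ (L : ℕ), 1 < L → ∀ (b₀ p₀ : ℝ), 0 < b₀ → 0 < p₀ → ∀ (C a₀ δ : ℝ), 0 ≤ C → 0 < a₀ → 0 < δ →
      ∃ γ₁ : ℝ, 0 < γ₁ ∧ ∀ (γ : ℝ), 0 < γ → γ ≤ γ₁ →
        (∀ i : ℕ, 0 ≤ θBal L γ b₀ p₀ i ∧ θBal L γ b₀ p₀ i ≤ a₀) ∧
        ∀ (J K : ℕ), J ≤ K → C * ∑ i ∈ Finset.range (K - J), θBal L γ b₀ p₀ (K - i) ≤ δ) :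
    ∀ (L : ℕ) (b₀ p₀ : ℝ), 0 < b₀ → 0 < p₀ → ∀ (δ : ℝ), 0 < δ →
      ∃ γ₁ : ℝ, 0 < γ₁ ∧ ∀ (F : T3Family) (γ : ℝ), F.L = L → 0 < γ → γ ≤ γ₁ →
        ∀ (J K : ℕ) (hJK : J ≤ K) (V : GaugeField (F.P J) 0 (Matrix.specialUnitaryGroup (Fin 2) ℂ)),
          ∀ U' ∈ fibre F ℰp J K hJK V, U' ∈ histGood F ℰp (θBal F.L γ b₀ p₀) K J →
            ∀ U ∈ fibre F ℰp J K hJK V, U ∈ histGood F ℰp (θBal F.L γ b₀ p₀) K J →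
              ∃ w : Site (F.P K) 0 → Matrix.specialUnitaryGroup (Fin 2) ℂ,
                (∀ U'' : GaugeField (F.P K) 0 (Matrix.specialUnitaryGroup (Fin 2) ℂ),
                    descendTo F ℰp J K hJK (GaugeField.gaugeAct w U'') = descendTo F ℰp J K hJK U'') ∧
                  ∀ ℓ : PBond (F.P K) 0, dist1 (U ℓ * ((GaugeField.gaugeAct w U') ℓ)⁻¹) ≤ δ := by
  intro L b₀ p₀ hb hp δ hδ
  by_cases hL : 1 < L
  swap
  · -- no family has this block size: everything is vacuous
    refine ⟨1, one_pos, fun F γ hFL => ?_⟩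
    exact absurd (hFL ▸ F.hL.2) hL
  obtain ⟨C, hC, a₀, ha₀, H1⟩ := h1 L
  obtain ⟨γ₁, hγ₁, HS⟩ := hS L hL b₀ p₀ hb hp C a₀ δ hC ha₀ hδ
  refine ⟨γ₁, hγ₁, fun F γ hFL hγ hγle J K hJK V U' hU' hU'g U hU hUg => ?_⟩
  obtain ⟨hθ, hsum⟩ := HS γ hγ hγle
  subst hFL
  have hUg' : ∀ i, i ≤ K - J → PlaqSmall (θBal F.L γ b₀ p₀ (K - i))
      (Averaging.iter (fun i => BlockAveraging.blockAvg (P := F.P K) (j := i) ℰp) i U) :=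
    fun i hi => hUg i (by omega)
  have hU'g' : ∀ i, i ≤ K - J → PlaqSmall (θBal F.L γ b₀ p₀ (K - i))
      (Averaging.iter (fun i => BlockAveraging.blockAvg (P := F.P K) (j := i) ℰp) i U') :=
    fun i hi => hU'g i (by omega)
  have htop := iter_eq_of_mem_fibre F hJK hU' hU
  obtain ⟨w, hwk, hwdist⟩ := chain_of_oneStep F K (K - J) (Nat.sub_le K J) hC (fun i hi => H1 F rfl K i hi)
    (θBal F.L γ b₀ p₀) (fun i => (hθ i).1) (fun i => (hθ i).2) U' U hU'g' hUg' htop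
  exact ⟨w, residual_of_transfUp_eq_one F hJK hwk, fun ℓ => (hwdist ℓ).trans (hsum J K hJK)⟩

end Door

end Summit.QuantumFields.YangMills.Theorems.FluctuationComparisonRegPrIntLS2BetaClosePairOfOneStep

end
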